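import Mathlib
import HarnessLib
import HarnessLib.Audit
import Summits.QuantumFields.Statement
import HarnessLib.Audit.Status.Attr

/-!
Route: CoincidenceRotationBootstrap

DORMANT since 2026-08-26T19:37:30Z (reconciler: no traction for 5 d (last activity item-evidence-added at 2026-08-21T18:47:55Z); parked, not closed — `ledger route dormant route-QuantumFields-CoincidenceRotationBootstrap --off` to react) — unstaffed, not closed; items shared with open routes are served there. `ledger route dormant <id> --off` reactivates.

It suffices to show X = SigmaFiveWitness (realising card coincidence-lattice-rotation-bootstrap,
spine): for every compact simple Lie group G there are a faithful lattice representation r, a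
sequential scheme sch AT WEAK COUPLING (`sch.HasWeakCouplingLimit`: β_k = 2/g₀(a_k)² → ∞ — statement
re-type p116790, 2026-08-16) and a labelled Schwinger family S on ℝ⁴ (one species per
gauge-invariant local lattice observable) with EVERY clause of `YangMills` except the rotation half
of E1 — the weak-coupling limit, E0, E0', E2, E3, E4, translation invariance, invariance under the
PROPER hypercubic group W(B₄)∩SO(4) (the linear isometries permuting ±e_i, det 1), the
`IsYangMillsFor` convergence of Wilson's lattice theory along sch, non-triviality and
non-Gaussianity of the curvature species, the continuum and lattice mass gaps — AND invariance of
the curvature-species Schwinger functions under ONE rational rotation R_θ, cos θ = 3/5, sin θ = 4/5,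
in the (x₂,x₃) plane (the Σ5 coincidence isometry of ℤ⁴: ℤ⁴ ∩ R_θℤ⁴ = (2+i)ℤ[i] × ℤ², index 5). X =
HypercubicLimit ∧ (conclusion of CurvatureAmnesia), both carrying the weak-coupling clause (a
conjunct of the existence leg, a hypothesis of the amnesia crux); X → YangMills inside the deciding
theorem itself (crux-only form, rev 15, 2026-08-16): the species bookkeeping (renormalise every
species other than the curvature to 0 — the projected scheme keeps a, β, L, m of sch, so weak
coupling and HasLatticeMassGap are carried along — and extend the curvature-string functions by
zero) is PROVED inline in `closes`, the PROVED support EuclideanUpgrade (stmt-QuantumFields-8647,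
closed: θ/π ∉ ℚ by Niven, W(B₄)-conjugates give SO(2) in every coordinate plane, Givens generation
and continuity give SO(4)) upgrades proper-hypercubic + Σ5 to SO(4), and the OSData constructor
assembles the witness.
Lean: `open Literature.MathematicalPhysics.QuantumLattice Literature.MathematicalPhysics.AQFT
Literature.MathematicalPhysics.QuantumFieldTheory in let E := EuclideanSpace ℝ (Fin 4); ∀ (G : Type)
[Group G] [TopologicalSpace G] [IsTopologicalGroup G] [CompactSpace G], IsCompactSimpleLieGroup G →
letI : MeasurableSpace G := borel G; haveI : BorelSpace G := ⟨rfl⟩; ∃ (r : LatticeRep G) (sch :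
SpeciesScheme (YMSpecies G)) (S : LabelledSchwingerFamily (YMSpecies G) (E)),
sch.HasWeakCouplingLimit ∧ (S.IsNormalized ∧ S.IsHermitian ∧ S.HasLinearGrowth ∧
S.IsReflectionPositive ∧ S.IsSymmetric ∧ S.HasClusterProperty ∧ (∀ (n : ℕ) (k : Fin n → YMSpecies G)
(a : E) (F : SchwartzMap (Fin n → E) ℂ), IsOffDiagonal F → S n k (translateMulti a F) = S n k F) ∧
(∀ (n : ℕ) (k : Fin n → YMSpecies G) (R : E ≃ₗᵢ[ℝ] E), LinearMap.det (R.toLinearEquiv : E →ₗ[ℝ] E) =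
1 → (∀ i : Fin 4, ∃ j : Fin 4, R (EuclideanSpace.single i 1) = EuclideanSpace.single j 1 ∨ R
(EuclideanSpace.single i 1) = -EuclideanSpace.single j 1) → ∀ F : SchwartzMap (Fin n → E) ℂ,
IsOffDiagonal F → S n k (linActMulti R F) = S n k F)) ∧ (∀ (n : ℕ), n ≠ 0 → ∀ (σ : Fin n → YMSpecies
G) (f : Fin n → SchwartzMap (E) ℝ) (F : SchwartzMap (Fin n → E) ℂ), IsTensorOf F (fun i =>
ofRealTest (f i)) → IsOffDiagonal F → Filter.Tendsto (fun k : ℕ => ((latticeSchwinger r.ρ sch (fun s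
=> s.F) k n σ f : ℝ) : ℂ)) Filter.atTop (nhds (S n σ F))) ∧ (∃ (F₁ G₁ : SchwartzMap (Fin 1 → E) ℂ)
(H₁ : SchwartzMap (Fin (1 + 1) → E) ℂ), IsTimeOrdered F₁ ∧ IsTimeOrdered G₁ ∧ IsAppendTensorOf H₁
(osAdjoint F₁) G₁ ∧ S (1 + 1) (fun _ => r.curvature) H₁ ≠ S 1 (fun _ => r.curvature) (osAdjoint F₁)
* S 1 (fun _ => r.curvature) G₁) ∧ (∃ (f g h : SchwartzMap (E) ℂ) (Ffgh : SchwartzMap (Fin 3 → E) ℂ)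
(Fgh Ffh Ffg : SchwartzMap (Fin 2 → E) ℂ) (Ff Fg Fh : SchwartzMap (Fin 1 → E) ℂ), IsTensorOf Ffgh
![f, g, h] ∧ IsOffDiagonal Ffgh ∧ IsTensorOf Fgh ![g, h] ∧ IsTensorOf Ffh ![f, h] ∧ IsTensorOf Ffg
![f, g] ∧ IsTensorOf Ff ![f] ∧ IsTensorOf Fg ![g] ∧ IsTensorOf Fh ![h] ∧ S 3 (fun _ => r.curvature)
Ffgh - S 1 (fun _ => r.curvature) Ff * S 2 (fun _ => r.curvature) Fgh - S 1 (fun _ => r.curvature)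
Fg * S 2 (fun _ => r.curvature) Ffh - S 1 (fun _ => r.curvature) Fh * S 2 (fun _ => r.curvature) Ffg
+ 2 * (S 1 (fun _ => r.curvature) Ff * S 1 (fun _ => r.curvature) Fg * S 1 (fun _ => r.curvature)
Fh) ≠ 0) ∧ (∃ Δ : ℝ, 0 < Δ ∧ S.HasMassGap Δ ∧ HasLatticeMassGap r sch Δ) ∧ (∀ (R : E ≃ₗᵢ[ℝ] E), (R
(EuclideanSpace.single 0 1) = EuclideanSpace.single 0 1 ∧ R (EuclideanSpace.single 1 1) =
EuclideanSpace.single 1 1 ∧ R (EuclideanSpace.single 2 1) = (3/5 : ℝ) • EuclideanSpace.single 2 1 +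
(4/5 : ℝ) • EuclideanSpace.single 3 1 ∧ R (EuclideanSpace.single 3 1) = -((4/5 : ℝ) •
EuclideanSpace.single 2 1) + (3/5 : ℝ) • EuclideanSpace.single 3 1) → ∀ (n : ℕ) (F : SchwartzMap
(Fin n → E) ℂ), IsOffDiagonal F → S n (fun _ => r.curvature) (linActMulti R F) = S n (fun _ =>
r.curvature) F)`

## Assembly
Glue = the deciding theorem `closes (h₁ : CurvatureAmnesia) (h₂ : HypercubicLimit) (h₃ :
EuclideanUpgrade) : YangMills` (CRUX-ONLY form, rev 15, 2026-08-16: the two cruxes plus the PROVED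
support EuclideanUpgrade, stmt-QuantumFields-8647 — its landed proof `stub_upgrade` lives in a
Theorems module importing this file, so it cannot be invoked by name here; 195 lines, axioms propext
/ Classical.choice / Quot.sound; native audit ok): fix G; HypercubicLimit gives (r, sch, S) with
sch.HasWeakCouplingLimit and the clause package; CurvatureAmnesia, fed that weak-coupling clause as
its first hypothesis, gives Σ5-invariance of the curvature-string functions of S; the SPECIES
BOOKKEEPING is proved inline — sch' := sch with c_s := 0 for s ≠ r.curvature (same a, β, L, m, so
sch'.HasWeakCouplingLimit and HasLatticeMassGap r sch' Δ are the clauses of sch definitionally), S'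
n k := S n (curvature string) if every k i = r.curvature, else 0; S' inherits E0, E0', E2 (zero the
test functions of the non-curvature terms of the OS form), E3, E4, translations, proper-hypercubic
invariance and the full-spectrum HasMassGap from S, lattice correlators with a zero renormalisation
factor vanish (IsYangMillsFor along sch'), non-triviality / non-Gaussianity sit on curvature strings
where S' = S, and Σ5 holds for EVERY string of S' (curvature strings by CurvatureAmnesia, the others
are 0 = 0); EuclideanUpgrade (ι = YMSpecies G) turns proper-hypercubic + Σ5 into invariance under
every det-1 isometry; T := ⟨S', E0, E0', ⟨translations, rotations⟩, E2, E3, E4⟩ : OSData (YMSpecies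
G) 4 and the witness ⟨r, sch', T, weak coupling, IsYangMillsFor, IsNontrivial, IsNonGaussian, Δ,
HasMassGap, HasLatticeMassGap⟩. The item Assembly := CurvatureAmnesia → HypercubicLimit → YangMills
records that the two cruxes alone decide the summit (provable now: `fun h₁ h₂ => closes h₁ h₂
stub_upgrade` in a Theorems file importing
Theorems.LangevinControlUVOSLegsFromFemtoAndGapStubUpgrade). The former supports
WeakCouplingSpeciesProjection (content now inside `closes`), DensityLemma and GaussianPrimeAngle
(EuclideanUpgrade was proved directly from Mathlib `niven` + `AddSubgroup.dense_or_cyclic` + Givens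
generation, without them) were dropped at rev 15 as not load-bearing.

Rationale: WHY THIS LINE. E1 is the one Osterwalder–Schrader axiom the hypercubic lattice cannot carry
(RegularisationDichotomy) and every lattice route defers it to "Symanzik-type restoration"; pure
group theory reduces it to ONE emergent isometry: if a W(B₄)-invariant limit is also invariant under
the rational rotation (3+4i)/5 = (2+i)²/5 then, because arccos(3/5)/π is irrational (Niven1956;
Mathlib `niven`), the closed invariance group contains SO(2) in every coordinate plane, hence SO(4)
— the closing move of DKKMO2020Rotational §4.1 / ChelkakSmirnov2012 (invariance under a dense set of
angles, then closure), fed here by the arithmetic of coincidence-site lattices of ℤ⁴ (Zeiner2006,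
BaakeZeiner2008: Σ5 is the smallest planar coincidence index) instead of isoradial integrability,
which does not exist for 4D gauge theory. R_θ is a COINCIDENCE isometry, so the comparison "Wilson
on ℤ⁴a_k versus Wilson on R_θℤ⁴a_k" is a self-comparison of one theory with its own reflected block
image on the common index-5 hypercubic sublattice Λ = (2+i)ℤ[i]×ℤ² at the SAME (β_k, a_k): no
uniqueness of the continuum limit (ruling Y2; barrier UVStabilityNonUniqueness) and no improved
action (barrier ImprovedActionPositivityViolation) is used, and orientation memory is carried only
by W(B₄)-scalar O(4)-breaking operators of dimension ≥ 6 (Weisz1983, Symanzik1983, LuscherWeisz1985;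
numerically LangRebbi1982, DavoudiSavage2012). Imported areas: algebraic number theory of ℤ[i] /
crystallographic CSL theory, topological group theory (dense subgroups of SO(4)), Symanzik
effective-action bookkeeping. In the project the same arithmetic kernel drives route
SAWGaussianRotation (CriticalPhenomena/SAW, 2D, similarity z ↦ (2+i)z); the 4D massive setting
forbids similarities, which is exactly what the finite-index COINCIDENCE rotation buys. At filing
(2026-08-15) no route existed yet on QuantumFields/YangMills and the negatives index was empty.
Statement re-type 2026-08-16 (p116790, first conjunct `sch.HasWeakCouplingLimit`, β_k = 2/g₀² → ∞):
the Σ5 self-comparison never read β beyond "the same β_k on both parent lattices", so the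
weak-coupling clause is simply threaded — a conjunct of the existence leg and of the target, carried
through the species bookkeeping (proved inside `closes` since rev 15; the projected scheme keeps a,
β, L, m), and a new first HYPOTHESIS of CurvatureAmnesia, which only weakens that crux: the
hypothetical finite-β critical-point scaling limits (BhanotCreutz1981) that its old why-might-fail
had to cover are no longer in scope.

RANKED CRUXES. #0 Target (target) — X = SigmaFiveWitness as in § Thesis: ∀ compact simple G, ∃ (r,
sch, S) with sch.HasWeakCouplingLimit and all clauses of YangMills except rotations,
proper-hypercubic and translation invariance, and Σ5-invariance of the curvature-species Schwinger
functions on ⁰𝒮. (why it might fail: Inherits HypercubicLimit (weak-coupling existence + uniform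
gap, the open core) and CurvatureAmnesia (non-perturbative irrelevance of O(4)-breaking dimension-6
operators through the crossover, no small parameter).) [JaffeWitten2000, DKKMO2020Rotational,
Symanzik1983, Zeiner2006] #2 CurvatureAmnesia (crux) — card K1 in continuum form (ORIENTATION
AMNESIA; re-typed 2026-08-16 with the weak-coupling hypothesis): for every compact simple G, every
faithful lattice representation r, every sequential scheme sch at weak coupling
(sch.HasWeakCouplingLimit, β_k → ∞) and every labelled Schwinger family S on ℝ⁴ that has E0, E0',
E2, E3, E4, translation and proper-hypercubic invariance on ⁰𝒮, IS the joint limit of the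
renormalised Wilson lattice correlations along sch (the body of IsYangMillsFor), is non-trivial in
the curvature species and has a continuum and a uniform lattice mass gap Δ > 0, the Schwinger
functions of the curvature species tr F² (every arity, on ⁰𝒮) are invariant under the Σ5 rotation R
(R e₀ = e₀, R e₁ = e₁, R e₂ = (3e₂+4e₃)/5, R e₃ = (−4e₂+3e₃)/5). Intended engine (layer 2): one-step
commensurate self-comparison on Λ = (2+i)ℤ[i]×ℤ² — the Λ-blocked law of μ_k and its image under the
Λ-symmetry g = R_θ∘σ₃ (which swaps ℤ⁴ and R_θℤ⁴) agree asymptotically on Λ-local gauge-invariant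
observables at physical separation. [difficulty: open-problem] (why it might fail: Needs
non-perturbative irrelevance of the W(B4)-scalar O(4)-breaking dim-6 operators (Weisz1983) through
the crossover with no small parameter but (a/l)^2; e1-counterexample-zoo shows the kinematic guards
(W(B4), axis RP, clustering, gap, β_k → ∞) alone never force it.) [Symanzik1983, Weisz1983,
LuscherWeisz1985, LangRebbi1982, DavoudiSavage2012, DKKMO2020Rotational,
book:editornd-lattice-gauge-theories-monte-carlo-simulations p450-458] #3 HypercubicLimit (crux) —
the EXISTENCE LEG (imported complement, = YangMills minus rotations under the re-typed statement;
`YangMills → HypercubicLimit` is re-proved in the repair planner's Sketch.lean): for every compact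
simple G there are r, a sequential scheme sch at weak coupling (sch.HasWeakCouplingLimit: β_k =
2/g₀² → ∞) and a labelled Schwinger family S on ℝ⁴ over YMSpecies G with E0 (normalisation,
hermiticity), E0', E2, E3, E4, translation invariance and proper-hypercubic invariance on ⁰𝒮, the
IsYangMillsFor convergence of Wilson's lattice theory along sch to S, non-triviality and
non-Gaussianity of the curvature species, and Δ > 0 with S.HasMassGap Δ and HasLatticeMassGap r sch
Δ. Every UV+IR route (Bałaban RG, flow-line state space, finite-size criterion, curvature/LSI
closers) outputs exactly this; this route adds nothing to it and bets on them. [difficulty: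
open-problem] (why it might fail: It is the Millennium existence-and-gap problem minus rotations:
tightness of renormalised tr F^2 correlators along a weak-coupling Wilson scheme and a mass gap
uniform in the volume are both open (Balaban stops at UV stability; JaffeWitten2000 §6.5).)
[JaffeWitten2000, Balaban1987RG1, Balaban1989LargeFieldII, ChatterjeeYMProb2019,
OsterwalderSeiler1978, Literature.Barriers.QuantumFields.UVStabilityNonUniqueness] #9
EuclideanUpgrade (support) — card P1 in analytic form (DENSITY UPGRADE, provable now): for any label
type ι and any labelled Schwinger family S on ℝ⁴, if S is invariant on ⁰𝒮 under every proper
hypercubic isometry (det 1, permutes ±e_i) and under the Σ5 rotation R, then S is invariant on ⁰𝒮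
under every linear isometry of determinant 1 (the rotation half of E1). Proof: the invariance set is
a subgroup of E ≃ₗᵢ E closed in the operator norm (each S n k is continuous on 𝓢 and T ↦ linActMulti
T F is continuous into 𝓢; IsOffDiagonal is preserved); DensityLemma gives density in SO(4).
[difficulty: provable-now] [DKKMO2020Rotational, OsterwalderSchrader1973, Niven1956] #1 Assembly
(assembly; restated rev 15) — CurvatureAmnesia → HypercubicLimit → YangMills: the two cruxes alone
decide the summit; provable now as `fun h₁ h₂ => closes h₁ h₂ stub_upgrade` in a Theorems file
importing Theorems.LangevinControlUVOSLegsFromFemtoAndGapStubUpgrade (the deciding theorem `closes`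
takes EuclideanUpgrade as a third hypothesis only because that landed proof imports this file and
cannot be named in it). DROPPED at rev 15 (crux-only repair, not load-bearing, nothing refuted):
WeakCouplingSpeciesProjection (stmt-QuantumFields-16155; the species bookkeeping — sch' := sch with
c_s := 0 off the curvature, S' := S on all-curvature strings and 0 elsewhere, inheriting E0, E0',
E2, E3, E4, translations, hypercubic invariance, HasMassGap, IsYangMillsFor along sch',
non-triviality, non-Gaussianity — is now the body of `closes`), DensityLemma
(stmt-QuantumFields-8648) and GaussianPrimeAngle (stmt-QuantumFields-8649) — EuclideanUpgrade
(stmt-QuantumFields-8647) was PROVED directly (stub_upgrade over Upgrade.of_hyper_of_sigma5: Mathlib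
`niven`, `AddSubgroup.dense_or_cyclic`, conjugation of the Σ5 rotation into the (x₀,x₁) plane,
Givens generation, orbit continuity on 𝓢) without either. SHARING: HypercubicLimit
(stmt-QuantumFields-16154) is wanted verbatim by route MirrorModularBoosts (its
WeakCouplingHypercubicLimit); PencilRigidity carries the one-field-gauge variant
(stmt-QuantumFields-16120), equivalent by the same bookkeeping.

TWO-LAYER PLAN. Foreseen glued splits (none filed now; k ≤ 3, depth 1). CurvatureAmnesia ⇐
BlockAmnesia → BlockedCurvatureSpans → CurvatureAmnesia: BlockAmnesia = the card's LATTICE statement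
(for Λ-local bounded gauge-invariant A, B built from path holonomies along Λ = (2+i)ℤ[i]×ℤ², the
connected correlator of A and τ_x B under μ_k minus that of A∘g and τ_(gx) B∘g, g = R_θ∘σ₃ ∈ W_Λ \
W(B₄), is o(normalisation) at physical separation along the scheme — needs the definition request
blockHolonomy); BlockedCurvatureSpans = blocked Λ-plaquettes, renormalised, converge on ⁰𝒮 to a
non-zero multiple of the curvature field of S (so amnesia of blocked species is amnesia of tr F²). A
cheaper first child: TwoPointAmnesia (n = 2 only; the RP spectral representation of the curvature
two-point function in the e₂ and in the g-rotated time directions). (The foreseen split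
EuclideanUpgrade ⇐ DensityLemma → OrbitContinuity is moot: EuclideanUpgrade is proved.) Optional
strengthening NOT filed: the card's K2 (dyadic Cauchy estimate on 2ℤ⁴ ⊂ ℤ⁴ with a rate ⇒ convergence
along the whole dyadic scheme), useful only to uniqueness-hungry routes.

KILL CRITERIA. ¬CurvatureAmnesia by an explicit scheme (a compact simple G, Wilson action, β_k → ∞)
whose subsequential limit satisfies every guard but has an anisotropic tr F² two-point function
closes the route `refuted:CurvatureAmnesia` and is a major negative fact for every lattice route (E1
would then need a different regularisation). A 16-mirror-RP proof of O(4) (card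
sixteen-mirrors-o4-rigidity, conjecture R₄) moots CurvatureAmnesia but not the route's supports
(EuclideanUpgrade serves it too: it also ends with a density step). ¬HypercubicLimit is ¬YangMills
minus rotations — the summit itself would be in doubt; close `refuted:HypercubicLimit`. If a
Statement revision forbids zero renormalisations of the non-curvature species (the bookkeeping
inside `closes`), pivot CurvatureAmnesia to AllSpeciesAmnesia (Σ5 for every W(B₄)-invariant species
string) — same mechanism, more bookkeeping — and re-prove `closes` without the projection.

NOT DECOMPOSED YET. The lattice engine (block maps, CSL/DSC arithmetic ℤ⁴ ∩ R_θℤ⁴ = (2+i)ℤ[i]×ℤ²,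
the reflection g fixing Λ and swapping the two parent lattices — card P2) is deliberately not an
item: it needs the blockHolonomy definition and is the layer-2 split of CurvatureAmnesia. No rate,
no dyadic Cauchy estimate (card K2), no statement about non-scalar species, no use of diagonal
mirrors. Continuity of the O(4)-orbit map on 𝓢 was settled inside the landed proof of
EuclideanUpgrade.

CHEAPEST FALSIFIER. (i) Arithmetic (done, passes): 3/5 is not the cosine of an angle between F₄
roots (those are 0, ±1/2, ±1/√2, ±1), so ⟨W(B₄), R_θ⟩ is infinite and the density step of
EuclideanUpgrade is not vacuous; Mathlib's `niven` gives θ/π ∉ ℚ. (ii) Logic (done, passes; re-run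
2026-08-16 against the re-typed statement and again for the crux-only form): `YangMills →
HypercubicLimit`, `CurvatureAmnesia → HypercubicLimit → Target` (repair gen 2 Sketch.lean) and the
crux-only `closes : CurvatureAmnesia → HypercubicLimit → EuclideanUpgrade → YangMills` with the
species bookkeeping inline (repair gen 3 Sketch2.lean = the submitted glue verbatim, rc 0, 0
sorries, axioms propext / Classical.choice / Quot.sound; native `#h21_check_closes` ok on the
gate-rendered file) are proved sorry-free, so the existence leg is a genuine weakening and the glue
closes. (iii) Numerics (not run; the refuter's first move): on stored SU(2) Wilson configurations at
β = 2.4, 2.5, 2.6 measure the orientation memory M(ℓ) = relative difference of the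
plaquette–plaquette (action-density) connected correlator at lattice separations x ∈ (2−i)ℤ[i]×ℤ²
and R_θx ∈ (2+i)ℤ[i]×ℤ² that are NOT related by a lattice symmetry (equal Euclidean length; the
first such pair is x = n·(0,0,5,0) ↦ R_θx = n·(0,0,3,4), on-axis versus 3-4-5 off-axis) at fixed
physical ℓ = 5na: it must fall ∝ a² (LangRebbi1982 saw restoration for the static potential through
the crossover); a plateau kills CurvatureAmnesia for Wilson's action.

NUMBERS. cos θ = 3/5, sin θ = 4/5, θ = 2·arctan(1/2) = 53.13°; coincidence index Σ = 5 (smallest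
planar coincidence index of ℤ⁴; Zeiner2006); |W(B₄)| = 384, proper part 192; O(4)-breaking
W(B₄)-scalars start at dimension 6 (three dimension-6 operators in pure gauge theory, one of them
Σ_μν tr(D_μF_μν)² breaks O(4): Weisz1983, LuscherWeisz1985), so the expected orientation memory at
physical distance ℓ is O((a/ℓ)² · logs). Lang–Rebbi: rotational symmetry of the SU(2) static
potential visibly restored between β = 2 and β = 2.25
(book:editornd-lattice-gauge-theories-monte-carlo-simulations p. 453, Fig. 1). Items at open: 8 (2
cruxes, 4 supports, target, assembly). Cone (route-repair gen 1, 2026-08-15): the constant-level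
dependency cone of the 8 items + `closes` is 81 project constants with 0 unproved named facts (gate
`#h21_route_deps`); the route has NO imports of its own (its one redundant import, YangMillsOS —
already imported by Summits.QuantumFields.Statement — was dropped; the file re-elaborates
unchanged); the 5 module-level facts flagged by the dispatcher ride the mandatory import chain of
Summits/QuantumFields/YangMills/Statement.lean (YangMillsOS → YangMillsEuclidean | ContinuumLimitLGT
→ LatticeGaugeDLR, GaugeGroups → ConstructiveQFTWave0): ClayYangMillsEuclidean,
ClayYangMillsEuclideanGap, ClayYangMillsEuclideanAlong and CaoParkSheffieldProblem are
`@[conjecture]` / [status: open] (the Clay problem itself and the d = 4 weak-coupling area law —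
never facts, never hypotheses here), and isSpecification_ymSpecification is refuted as stated
(not_isSpecification_ymSpecification_indiscrete) with its [T2Space] twin
isSpecification_ymSpecification_t2_holds proved; none is a hypothesis or dependency of any item;
needs-fact: none. Repair gen 2 (statement re-type p116790, 2026-08-16T17:02Z, `def YangMills` gained
the first conjunct `sch.HasWeakCouplingLimit`): HypercubicLimit carries the new first conjunct
`sch.HasWeakCouplingLimit ∧` (item stmt-QuantumFields-16154; the pre-re-type stmt-QuantumFields-8646
stays with MirrorModularBoosts — a first atomic restate at 17:40:52Z was answered farm-unavailable
yet left this route's 8646 entry `replaced`, so the leg was re-added by name);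
WeakCouplingSpeciesProjection (stmt-QuantumFields-16155; W := fun r sch S =>
sch.HasWeakCouplingLimit ∧ …) supersedes SpeciesProjection (dropped); CurvatureAmnesia gets the new
first hypothesis `sch.HasWeakCouplingLimit →`, Target the new first conjunct, Assembly the renamed
chain; EuclideanUpgrade (proved), DensityLemma, GaussianPrimeAngle verbatim; `closes :
CurvatureAmnesia → HypercubicLimit → WeakCouplingSpeciesProjection → EuclideanUpgrade → YangMills`
threads hW ↦ hW' into the witness (native audit ok, std axioms); 8 items, 2 cruxes. Repair gen 3
(2026-08-16, gate stamp needs_repair = glue.non-crux-hypothesis on WeakCouplingSpeciesProjection;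
human ruling 2026-08-16: only CRUX items — and proved supports — may be hypotheses of `closes`):
`closes (h₁ : CurvatureAmnesia) (h₂ : HypercubicLimit) (h₃ : EuclideanUpgrade) : YangMills` with the
species bookkeeping proved inline (195 lines, 10.1 k chars, no commands, starts with `theorem
closes`; cone binder_used = in_cone = {CurvatureAmnesia, HypercubicLimit, EuclideanUpgrade});
WeakCouplingSpeciesProjection, DensityLemma, GaussianPrimeAngle dropped; Assembly restated
CurvatureAmnesia → HypercubicLimit → YangMills; no imports added (the landed ExtendByZero /
OneFieldReduction bookkeeping modules import the sibling thesis PencilRigidity and OneFieldReduction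
still names the dropped PencilRigidity.HypercubicLimit, so they were deliberately NOT imported;
Upgrade's modules import this file); items 5 (2 cruxes, 1 proved support, target, assembly); cone
facts: the 3 dispatcher-flagged ClayYangMillsEuclidean, ClayYangMillsEuclideanGap,
ClayYangMillsEuclideanAlong remain `@[conjecture]` [status: open] renderings of the Clay problem in
the Statement's own chain (YangMillsOS → YangMillsEuclidean) — not droppable by any route, not
hypotheses, gate constant-level cone 0 unproved; needs-fact: none.

DEFINITION REQUESTS. To be filed after open, for the layer-2 split only (nothing at open depends on
it): `blockHolonomy` — gauge-covariant block map "holonomy of an LGConfig 4 G along a fixed lattice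
path" onto the links of a commensurate sublattice given by an injective ℤ-linear map ℤ⁴ → ℤ⁴ (topic
Literature/MathematicalPhysics/QuantumLattice, next to LGConfig / configShift / plaquetteObs). Cite
facts: none needed (all sources enter as heuristics for cruxes, not as hypotheses).

Novelty: Searches (2026-08-15): `lit galaxy search "coincidence site lattice" --star all` (20 rows, all
crystallography/materials, none QFT);
`lit search "coincidence site lattices hypercubic lattice four dimensions quaternions Baake Zeiner"`
(local 2: arXiv:0709.1341,
arXiv:1301.3689; crossref 10 incl. doi:10.1524/zkri.2006.221.2.105, doi:10.1080/14786430701846206);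
`lit search --hybrid "restoration
rotational symmetry continuum limit lattice gauge theory Euclidean invariance"` (12 held books;
Lang–Rebbi reprint located at
book:editornd-lattice-gauge-theories-monte-carlo-simulations pp. 450–458; ChatterjeeYMProb2019
Problems 5.1–5.2 read, pp. 16–17);
`lit search --source arxiv "rotational invariance lattice gauge theory continuum limit"` (9:
arXiv:1204.4146 the only relevant one);
`lit search --source zbmath "rotation invariance scaling limit lattice model universality dense set
of angles"` (0); `lit frontier
QuantumFields --since 2021` (30 rows; no work on E1 for gauge theories; arXiv:2606.19362 claims an
RP construction, autopsied by card
faizal-shabir-rp-construction-autopsy); `lean search Niven` (Mathlib/NumberTheory/Niven.lean;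
sibling route
Summits/CriticalPhenomena/SAWScalingLimit/Theses/SAWGaussianRotation.lean found). OpenAlex/S2
returned HTTP 429 (recorded, not relied on).
Nearest prior art found: DKKMO2020Rotational (arXiv:2012.11672, Thm 1.1 via universality on
isoradial rectangular lattices, 2D, exact
track exchanges) and ChelkakSmirnov2012; in-project route-CriticalPhen  [refs: 10.1524/zkri.2006.221.2.105, 10.1080/14786430701846206, 0709.1341, 1301.3689, 1204.4146, 2606.19362, 2012.11672, doi:10.1524/zkri.2006.221.2.105, doi:10.1080/14786430701846206, book:editornd-lattice-gauge-theories-monte-carlo-simulations, ChatterjeeYMProb2019, ChelkakSmirnov2012, Symanzik1983, Weisz1983, DavoudiSavage2012, Zeiner2006, BaakeZeiner2008]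

Barriers (technique_class: coincidence-site-lattice-universality, density-upgrade): - technique_class: coincidence-site-lattice-universality, density-upgrade
- Literature.Barriers.QuantumFields.RegularisationDichotomy: this is the barrier the route answers —
the lattice keeps reflection positivity (closed under limits, carried in HypercubicLimit) and E1 is
RECOVERED in the limit by CurvatureAmnesia + EuclideanUpgrade; no regularisation with both
properties is claimed.
- Literature.Barriers.QuantumFields.UVStabilityNonUniqueness: respected, not evaded — every item
speaks of ONE subsequential limit S along a sequence (ruling Y2); the Σ5 comparison is at the same
(β_k, a_k) through a common sublattice, so no uniqueness across cutoffs is used (the printed device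
for recovering an axiom, Rivasseau §I.3.D, is exactly what the route avoids).
- Literature.Barriers.QuantumFields.ImprovedActionPositivityViolation: evaded — Wilson's action
verbatim at every k (RP intact, HasLatticeMassGap meaningful); dimension-6 operators appear only in
the ANALYSIS of orientation memory, never in the measure.
- Literature.Barriers.QuantumFields.FixedCouplingUltralocality: not in class — the guards
(non-triviality on ⁰𝒮 + gap) exclude fixed-β schemes, whose limits are ultralocal and trivially
isotropic; the crux lives at β_k → ∞.
- Literature.Barriers.QuantumFields.PerturbativeInvisibility: untouched — nothing is expanded in g;
the gap is imported (HypercubicLimit), not computed.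
- Negatives index: empty at filing (`ledger negatives --problem QuantumFields`: no refuted
statements).

History (route lifecycle, newest last):
- 2026-08-16T17:58:36Z · rev 13: restated CurvatureAmnesia (stmt-QuantumFields-8645), Target (stmt-QuantumFields-8644), Assembly (stmt-QuantumFields-8651) — route-repair (statement-revised p116790, step B of 2): restate CurvatureAmnesia (new first hypothesis sch.HasWeakCouplingLimit — the re-typed summit pins β_k → (planner-rrepair-QuantumFields-CoincidenceRotat-b0ce4f17-0)
- 2026-08-16T18:01:39Z · rev 14: dropped SpeciesProjection — route-repair (statement-revised p116790, step C): drop SpeciesProjection (stmt-QuantumFields-8650) — superseded by WeakCouplingSpeciesProjection (stmt-QuantumFi (planner-rrepair-QuantumFields-CoincidenceRotat-b0ce4f17-0)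
- 2026-08-16T18:31:50Z · rev 15: restated Assembly (stmt-QuantumFields-16194) — @note.txt (planner-rbadge-QuantumFields-CoincidenceRotati-1d1bad44-g3-0)
- 2026-08-16T18:31:50Z · rev 15: dropped WeakCouplingSpeciesProjection, DensityLemma, GaussianPrimeAngle — @note.txt (planner-rbadge-QuantumFields-CoincidenceRotati-1d1bad44-g3-0)
- 2026-08-26T19:37:30Z · DORMANT — reconciler: no traction for 5 d (last activity item-evidence-added at 2026-08-21T18:47:55Z); parked, not closed — `ledger route dormant route-QuantumFields-Coin (operator:999:2676607)

sub-problem: YangMills · status: dormant · opened planner-plancard-QuantumFields-YangMills-coin-ba8cc9d5-0 2026-08-15T13:25:58Z · rev 16 · ledger route-QuantumFields-CoincidenceRotationBootstrap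
GENERATED by the gate from the ledger (D-0016/17). Provers cite these decls: `theorem foo : Summit.QuantumFields.YangMills.Theses.CoincidenceRotationBootstrap.<Decl> := …` in Summits/QuantumFields/YangMills/Theorems/<Name>.lean.
-/

namespace Summit.QuantumFields.YangMills.Theses.CoincidenceRotationBootstrap

open scoped BigOperators Topology Manifold Classical MeasureTheory ProbabilityTheory Matrix InnerProductSpace ComplexConjugate ContinuousMap
open Filter Set Function TopologicalSpace MeasureTheory

attribute [summit_statement] _root_.YangMills

-- earlier Target (stmt-QuantumFields-8644, replaced 2026-08-16T17:58:36Z -> stmt-QuantumFields-16193): retired by None — open Literature.MathematicalPhysics.QuantumLattice Literature.MathematicalPhysics.AQFT Literature.MathematicalPhysics.QuantumFieldTheory in let E := EuclideanSpace ℝ (Fin 4); ∀ (G : Type) [Group G] [TopologicalSpace G] [IsTopologicalGroup G] [CompactSpace G], IsCompactSimpleLieGro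
/-- item stmt-QuantumFields-16193 · target · rank 0 · open · by planner
why it might fail: X = HypercubicLimit ∧ Σ5-amnesia inherits the open weak-coupling existence + uniform-gap core (HypercubicLimit: Chatterjee Problems 5.1–5.2 unproved) and the unproved non-perturbative (a/ℓ)² irrelevance of the dim-6 O(4)-breaking operators (CurvatureAmnesia); either failing sinks X.
sources: JaffeWitten2000, DKKMO2020Rotational, Symanzik1983, Weisz1983, Zeiner2006, book:friz2019-probability-analysis-interacting-physical-systems p15-17
[target] X = SigmaFiveWitness as in § Thesis (re-typed 2026-08-16 with the weak-coupling conjunct of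
p116790): ∀ compact simple G, ∃ (r, sch, S) with sch.HasWeakCouplingLimit and all clauses of
YangMills except rotations, proper-hypercubic and translation invariance, and Σ5-invariance of the
curvature-species Schwinger functions on ⁰𝒮; X = HypercubicLimit ∧ (conclusion of CurvatureAmnesia),
and Target → WeakCouplingSpeciesProjection → EuclideanUpgrade → YangMills is proved in the repair
planner's Sketch.lean. -/
@[route_item "route-QuantumFields-CoincidenceRotationBootstrap"]
def Target : Prop :=
  open Literature.MathematicalPhysics.QuantumLattice Literature.MathematicalPhysics.AQFT Literature.MathematicalPhysics.QuantumFieldTheory in let E := EuclideanSpace ℝ (Fin 4); ∀ (G : Type) [Group G] [TopologicalSpace G] [IsTopologicalGroup G] [CompactSpace G], IsCompactSimpleLieGroup G → letI : MeasurableSpace G := borel G; haveI : BorelSpace G := ⟨rfl⟩; ∃ (r : LatticeRep G) (sch : SpeciesScheme (YMSpecies G)) (S : LabelledSchwingerFamily (YMSpecies G) (E)), sch.HasWeakCouplingLimit ∧ (S.IsNormalized ∧ S.IsHermitian ∧ S.HasLinearGrowth ∧ S.IsReflectionPositive ∧ S.IsSymmetric ∧ S.HasClusterProperty ∧ (∀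 (n : ℕ) (k : Fin n → YMSpecies G) (a : E) (F : SchwartzMap (Fin n → E) ℂ), IsOffDiagonal F → S n k (translateMulti a F) = S n k F) ∧ (∀ (n : ℕ) (k : Fin n → YMSpecies G) (R : E ≃ₗᵢ[ℝ] E), LinearMap.det (R.toLinearEquiv : E →ₗ[ℝ] E) = 1 → (∀ i : Fin 4, ∃ j : Fin 4, R (EuclideanSpace.single i 1) = EuclideanSpace.single j 1 ∨ R (EuclideanSpace.single i 1) = -EuclideanSpace.single j 1) → ∀ F : SchwartzMap (Fin n → E) ℂ, IsOffDiagonal F → S n k (linActMulti R F) = S n k F)) ∧ (∀ (n : ℕ), n ≠ 0 → ∀ (σ : Fin n → YMSpecies G) (f : Fin n → SchwartzMap (E) ℝ) (F : SchwartzMap (Fin n → E) ℂ), IsTensorOf F (fun i => ofRealTest (f i)) → IsOffDiagonal F → Filter.Tendsto (fun k : ℕ => ((latticeSchwinger r.ρ sch (fun s => s.F) k n σ f : ℝ) : ℂ)) Filter.atTop (nhds (S n σ F))) ∧ (∃ (F₁ G₁ : SchwartzMap (Fin 1 → E) ℂ) (H₁ : SchwartzMap (Fin (1 + 1) → E) ℂ),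 IsTimeOrdered F₁ ∧ IsTimeOrdered G₁ ∧ IsAppendTensorOf H₁ (osAdjoint F₁) G₁ ∧ S (1 + 1) (fun _ => r.curvature) H₁ ≠ S 1 (fun _ => r.curvature) (osAdjoint F₁) * S 1 (fun _ => r.curvature) G₁) ∧ (∃ (f g h : SchwartzMap (E) ℂ) (Ffgh : SchwartzMap (Fin 3 → E) ℂ) (Fgh Ffh Ffg : SchwartzMap (Fin 2 → E) ℂ) (Ff Fg Fh : SchwartzMap (Fin 1 → E) ℂ), IsTensorOf Ffgh ![f, g, h] ∧ IsOffDiagonal Ffgh ∧ IsTensorOf Fgh ![g, h] ∧ IsTensorOf Ffh ![f, h] ∧ IsTensorOf Ffg ![f, g] ∧ IsTensorOf Ff ![f] ∧ IsTensorOf Fg ![g] ∧ IsTensorOf Fh ![h] ∧ S 3 (fun _ => r.curvature) Ffgh - S 1 (fun _ => r.curvature) Ff * S 2 (fun _ => r.curvature) Fgh - S 1 (fun _ => r.curvature) Fg * S 2 (fun _ => r.curvature) Ffh - S 1 (fun _ => r.curvature) Fh * S 2 (fun _ => r.curvature) Ffg + 2 * (S 1 (fun _ => r.curvature) Ff * S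 1 (fun _ => r.curvature) Fg * S 1 (fun _ => r.curvature) Fh) ≠ 0) ∧ (∃ Δ : ℝ, 0 < Δ ∧ S.HasMassGap Δ ∧ HasLatticeMassGap r sch Δ) ∧ (∀ (R : E ≃ₗᵢ[ℝ] E), (R (EuclideanSpace.single 0 1) = EuclideanSpace.single 0 1 ∧ R (EuclideanSpace.single 1 1) = EuclideanSpace.single 1 1 ∧ R (EuclideanSpace.single 2 1) = (3/5 : ℝ) • EuclideanSpace.single 2 1 + (4/5 : ℝ) • EuclideanSpace.single 3 1 ∧ R (EuclideanSpace.single 3 1) = -((4/5 : ℝ) • EuclideanSpace.single 2 1) + (3/5 : ℝ) • EuclideanSpace.single 3 1) → ∀ (n : ℕ) (F : SchwartzMap (Fin n → E) ℂ), IsOffDiagonal F → S n (fun _ => r.curvature) (linActMulti R F) = S n (fun _ => r.curvature) F)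

-- earlier CurvatureAmnesia (stmt-QuantumFields-8645, replaced 2026-08-16T17:58:36Z -> stmt-QuantumFields-16192): retired by None — open Literature.MathematicalPhysics.QuantumLattice Literature.MathematicalPhysics.AQFT Literature.MathematicalPhysics.QuantumFieldTheory in let E := EuclideanSpace ℝ (Fin 4); ∀ (G : Type) [Group G] [TopologicalSpace G] [IsTopologicalGroup G] [CompactSpace G], IsCompactSi
/-- item stmt-QuantumFields-16192 · crux · rank 2 · open · by planner
why it might fail: Non-perturbative (a/ℓ)² irrelevance of the W(B₄)-scalar dim-6 O(4)-breaking operators (Weisz1983) along weak-coupling Wilson schemes is unproved — no small parameter but (a/ℓ)²; the guards (W(B₄), axis RP, clustering, gap, β_k→∞) alone never force Σ5-blindness (e1-counterexample-zoo).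
sources: Symanzik1983, Weisz1983, LuscherWeisz1985, LangRebbi1982, DavoudiSavage2012, DKKMO2020Rotational
[crux] card K1 in continuum form (ORIENTATION AMNESIA; re-typed 2026-08-16 with the weak-coupling
hypothesis of the revised statement p116790): for every compact simple G, every faithful lattice
representation r, every sequential scheme sch AT WEAK COUPLING (sch.HasWeakCouplingLimit: β_k =
2/g₀² → ∞) and every labelled Schwinger family S on ℝ⁴ that has E0, E0', E2, E3, E4, translation and
proper-hypercubic invariance on ⁰𝒮, IS the joint limit of the renormalised Wilson lattice
correlations along sch (the body of IsYangMillsFor), is non-trivial in the curvature species and has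
a continuum and a uniform lattice mass gap Δ > 0, the Schwinger functions of the curvature species
tr F² (every arity, on ⁰𝒮) are invariant under the Σ5 rotation R (R e₀ = e₀, R e₁ = e₁, R e₂ =
(3e₂+4e₃)/5, R e₃ = (−4e₂+3e₃)/5). Intended engine (layer 2): one-step commensurate self-comparison
on Λ = (2+i)ℤ[i]×ℤ² — the Λ-blocked law of μ_k and its image under the Λ-symmetry g = R_θ∘σ₃ (which
swaps ℤ⁴ and R_θℤ⁴) agree asymptotically on Λ-local gauge-invariant observables at physical
separation. [difficulty: open-problem] -/
@[route_item "route-QuantumFields-CoincidenceRotationBootstrap", crux]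
def CurvatureAmnesia : Prop :=
  open Literature.MathematicalPhysics.QuantumLattice Literature.MathematicalPhysics.AQFT Literature.MathematicalPhysics.QuantumFieldTheory in let E := EuclideanSpace ℝ (Fin 4); ∀ (G : Type) [Group G] [TopologicalSpace G] [IsTopologicalGroup G] [CompactSpace G], IsCompactSimpleLieGroup G → letI : MeasurableSpace G := borel G; haveI : BorelSpace G := ⟨rfl⟩; ∀ (r : LatticeRep G) (sch : SpeciesScheme (YMSpecies G)) (S : LabelledSchwingerFamily (YMSpecies G) (E)), sch.HasWeakCouplingLimit → (S.IsNormalized ∧ S.IsHermitian ∧ S.HasLinearGrowth ∧ S.IsReflectionPositive ∧ S.IsSymmetric ∧ S.HasClusterProperty ∧ (∀ (n : ℕ) (k : Fin n → YMSpecies G) (a : E) (F : SchwartzMap (Fin n → E) ℂ), IsOffDiagonal F → S n k (translateMulti a F) = S n k F) ∧ (∀ (n : ℕ) (k : Fin n → YMSpecies G) (R : E ≃ₗᵢ[ℝ] E), LinearMap.det (R.toLinearEquiv : E →ₗ[ℝ] E) = 1 → (∀ i : Fin 4, ∃ j : Fin 4, R (EuclideanSpace.single i 1) = EuclideanSpace.single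 j 1 ∨ R (EuclideanSpace.single i 1) = -EuclideanSpace.single j 1) → ∀ F : SchwartzMap (Fin n → E) ℂ, IsOffDiagonal F → S n k (linActMulti R F) = S n k F)) → (∀ (n : ℕ), n ≠ 0 → ∀ (σ : Fin n → YMSpecies G) (f : Fin n → SchwartzMap (E) ℝ) (F : SchwartzMap (Fin n → E) ℂ), IsTensorOf F (fun i => ofRealTest (f i)) → IsOffDiagonal F → Filter.Tendsto (fun k : ℕ => ((latticeSchwinger r.ρ sch (fun s => s.F) k n σ f : ℝ) : ℂ)) Filter.atTop (nhds (S n σ F))) → (∃ (F₁ G₁ : SchwartzMap (Fin 1 → E) ℂ) (H₁ : SchwartzMap (Fin (1 + 1) → E) ℂ), IsTimeOrdered F₁ ∧ IsTimeOrdered G₁ ∧ IsAppendTensorOf H₁ (osAdjoint F₁) G₁ ∧ S (1 + 1) (fun _ => r.curvature) H₁ ≠ S 1 (fun _ => r.curvature) (osAdjoint F₁) * S 1 (fun _ => r.curvature) G₁) → (∃ Δ : ℝ, 0 < Δ ∧ S.HasMassGap Δ ∧ HasLatticeMassGap r sch Δ) → (∀ (R : E ≃ₗᵢ[ℝ] E),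 (R (EuclideanSpace.single 0 1) = EuclideanSpace.single 0 1 ∧ R (EuclideanSpace.single 1 1) = EuclideanSpace.single 1 1 ∧ R (EuclideanSpace.single 2 1) = (3/5 : ℝ) • EuclideanSpace.single 2 1 + (4/5 : ℝ) • EuclideanSpace.single 3 1 ∧ R (EuclideanSpace.single 3 1) = -((4/5 : ℝ) • EuclideanSpace.single 2 1) + (3/5 : ℝ) • EuclideanSpace.single 3 1) → ∀ (n : ℕ) (F : SchwartzMap (Fin n → E) ℂ), IsOffDiagonal F → S n (fun _ => r.curvature) (linActMulti R F) = S n (fun _ => r.curvature) F)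

-- earlier HypercubicLimit (stmt-QuantumFields-8646, replaced 2026-08-16T17:40:52Z -> stmt-QuantumFields-15924): open — open Literature.MathematicalPhysics.QuantumLattice Literature.MathematicalPhysics.AQFT Literature.MathematicalPhysics.QuantumFieldTheory in let E := EuclideanSpace ℝ (Fin 4); ∀ (G : Type) [Group G] [TopologicalSpace G] [IsTopologicalGroup G] [CompactSpace G], IsCompactSimpleLieGroup
/-- item stmt-QuantumFields-16154 · crux · rank 3 · open · by planner
why it might fail: It is YangMills minus rotations: joint convergence of renormalised tr F² n-point functions along a weak-coupling Wilson scheme (β_k→∞) and a gap Δ>0 uniform in k AND in the volume (one C for all k, S) are open — Bałaban stops at UV stability; Chatterjee Problems 5.1–5.2 unproved.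
sources: JaffeWitten2000, Balaban1987RG1, Balaban1989LargeFieldII, ChatterjeeYMProb2019, book:friz2019-probability-analysis-interacting-physical-systems p16-17, OsterwalderSeiler1978
[crux] the EXISTENCE LEG (imported complement, = YangMills minus rotations under the re-typed
statement p116790; `YangMills → HypercubicLimit` is proved in the repair planner's Sketch.lean): for
every compact simple G there are r, a sequential scheme sch AT WEAK COUPLING
(sch.HasWeakCouplingLimit: β_k = 2/g₀² → ∞) and a labelled Schwinger family S on ℝ⁴ over YMSpecies G
with E0 (normalisation, hermiticity), E0', E2, E3, E4, translation invariance and proper-hypercubic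
invariance on ⁰𝒮, the IsYangMillsFor convergence of Wilson's lattice theory along sch to S,
non-triviality and non-Gaussianity of the curvature species, and Δ > 0 with S.HasMassGap Δ and
HasLatticeMassGap r sch Δ. Every UV+IR route (Bałaban RG, flow-line state space, finite-size
criterion, curvature/LSI closers) outputs exactly this; this route adds nothing to it and bets on
them. [difficulty: open-problem] -/
@[route_item "route-QuantumFields-CoincidenceRotationBootstrap", crux]
def HypercubicLimit : Prop :=
  open Literature.MathematicalPhysics.QuantumLattice Literature.MathematicalPhysics.AQFT Literature.MathematicalPhysics.QuantumFieldTheory in let E := EuclideanSpace ℝ (Fin 4); ∀ (G : Type) [Group G] [TopologicalSpace G] [IsTopologicalGroup G] [CompactSpace G], IsCompactSimpleLieGroup G → letI : MeasurableSpace G := borel G; haveI : BorelSpace G := ⟨rfl⟩; ∃ (r : LatticeRep G) (sch : SpeciesScheme (YMSpecies G)) (S : LabelledSchwingerFamily (YMSpecies G) (E)), sch.HasWeakCouplingLimit ∧ (S.IsNormalized ∧ S.IsHermitian ∧ S.HasLinearGrowth ∧ S.IsReflectionPositive ∧ S.IsSymmetric ∧ S.HasClusterProperty ∧ (∀ (n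 : ℕ) (k : Fin n → YMSpecies G) (a : E) (F : SchwartzMap (Fin n → E) ℂ), IsOffDiagonal F → S n k (translateMulti a F) = S n k F) ∧ (∀ (n : ℕ) (k : Fin n → YMSpecies G) (R : E ≃ₗᵢ[ℝ] E), LinearMap.det (R.toLinearEquiv : E →ₗ[ℝ] E) = 1 → (∀ i : Fin 4, ∃ j : Fin 4, R (EuclideanSpace.single i 1) = EuclideanSpace.single j 1 ∨ R (EuclideanSpace.single i 1) = -EuclideanSpace.single j 1) → ∀ F : SchwartzMap (Fin n → E) ℂ, IsOffDiagonal F → S n k (linActMulti R F) = S n k F)) ∧ (∀ (n : ℕ), n ≠ 0 → ∀ (σ : Fin n → YMSpecies G) (f : Fin n → SchwartzMap (E) ℝ) (F : SchwartzMap (Fin n → E) ℂ), IsTensorOf F (fun i => ofRealTest (f i)) → IsOffDiagonal F → Filter.Tendsto (fun k : ℕ => ((latticeSchwinger r.ρ sch (fun s => s.F) k n σ f : ℝ) : ℂ)) Filter.atTop (nhds (S n σ F))) ∧ (∃ (F₁ G₁ : SchwartzMap (Fin 1 → E) ℂ) (H₁ : SchwartzMap (Fin (1 + 1) → E) ℂ),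 IsTimeOrdered F₁ ∧ IsTimeOrdered G₁ ∧ IsAppendTensorOf H₁ (osAdjoint F₁) G₁ ∧ S (1 + 1) (fun _ => r.curvature) H₁ ≠ S 1 (fun _ => r.curvature) (osAdjoint F₁) * S 1 (fun _ => r.curvature) G₁) ∧ (∃ (f g h : SchwartzMap (E) ℂ) (Ffgh : SchwartzMap (Fin 3 → E) ℂ) (Fgh Ffh Ffg : SchwartzMap (Fin 2 → E) ℂ) (Ff Fg Fh : SchwartzMap (Fin 1 → E) ℂ), IsTensorOf Ffgh ![f, g, h] ∧ IsOffDiagonal Ffgh ∧ IsTensorOf Fgh ![g, h] ∧ IsTensorOf Ffh ![f, h] ∧ IsTensorOf Ffg ![f, g] ∧ IsTensorOf Ff ![f] ∧ IsTensorOf Fg ![g] ∧ IsTensorOf Fh ![h] ∧ S 3 (fun _ => r.curvature) Ffgh - S 1 (fun _ => r.curvature) Ff * S 2 (fun _ => r.curvature) Fgh - S 1 (fun _ => r.curvature) Fg * S 2 (fun _ => r.curvature) Ffh - S 1 (fun _ => r.curvature) Fh * S 2 (fun _ => r.curvature) Ffg + 2 * (S 1 (fun _ => r.curvature) Ff * S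 1 (fun _ => r.curvature) Fg * S 1 (fun _ => r.curvature) Fh) ≠ 0) ∧ (∃ Δ : ℝ, 0 < Δ ∧ S.HasMassGap Δ ∧ HasLatticeMassGap r sch Δ)

/-- item stmt-QuantumFields-8647 · support · rank 9 · closed · proved by Summit.QuantumFields.YangMills.Cruxes.OSLegsFromFemtoAndGap.DlrCollarTransfer.stub_upgrade (prover) · by planner
sources: DKKMO2020Rotational, OsterwalderSchrader1973, Niven1956
[support] card P1 in analytic form (DENSITY UPGRADE, provable now): for any label type ι and any
labelled Schwinger family S on ℝ⁴, if S is invariant on ⁰𝒮 under every proper hypercubic isometry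
(det 1, permutes ±e_i) and under the Σ5 rotation R, then S is invariant on ⁰𝒮 under every linear
isometry of determinant 1 (the rotation half of E1). Proof: the invariance set is a subgroup of E
≃ₗᵢ E closed in the operator norm (each S n k is continuous on 𝓢 and T ↦ linActMulti T F is
continuous into 𝓢; IsOffDiagonal is preserved); DensityLemma gives density in SO(4). [difficulty:
provable-now] -/
@[route_item "route-QuantumFields-CoincidenceRotationBootstrap", crux]
def EuclideanUpgrade : Prop :=
  open Literature.MathematicalPhysics.QuantumLattice Literature.MathematicalPhysics.AQFT Literature.MathematicalPhysics.QuantumFieldTheory in let E := EuclideanSpace ℝ (Fin 4); ∀ (ι : Type) (S : LabelledSchwingerFamily ι (E)), (∀ (n : ℕ) (k : Fin n → ι) (R : E ≃ₗᵢ[ℝ] E), LinearMap.det (R.toLinearEquiv : E →ₗ[ℝ] E) = 1 → (∀ i : Fin 4, ∃ j : Fin 4, R (EuclideanSpace.single i 1) = EuclideanSpace.single j 1 ∨ R (EuclideanSpace.single i 1) = -EuclideanSpace.single j 1) → ∀ F : SchwartzMap (Fin n → E) ℂ, IsOffDiagonal F → S n k (linActMulti R F) = S n k F) → (∀ (R :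 E ≃ₗᵢ[ℝ] E), (R (EuclideanSpace.single 0 1) = EuclideanSpace.single 0 1 ∧ R (EuclideanSpace.single 1 1) = EuclideanSpace.single 1 1 ∧ R (EuclideanSpace.single 2 1) = (3/5 : ℝ) • EuclideanSpace.single 2 1 + (4/5 : ℝ) • EuclideanSpace.single 3 1 ∧ R (EuclideanSpace.single 3 1) = -((4/5 : ℝ) • EuclideanSpace.single 2 1) + (3/5 : ℝ) • EuclideanSpace.single 3 1) → ∀ (n : ℕ) (k : Fin n → ι) (F : SchwartzMap (Fin n → E) ℂ), IsOffDiagonal F → S n k (linActMulti R F) = S n k F) → ∀ (n : ℕ) (k : Fin n → ι) (R : E ≃ₗᵢ[ℝ] E), LinearMap.det (R.toLinearEquiv : E →ₗ[ℝ] E) = 1 → ∀ F : SchwartzMap (Fin n → E) ℂ, IsOffDiagonal F → S n k (linActMulti R F) = S n k F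

-- `EuclideanUpgrade` holds: proved by `Summit.QuantumFields.YangMills.Cruxes.OSLegsFromFemtoAndGap.DlrCollarTransfer.stub_upgrade` (its module imports this route file, so no `_holds` link can be stated here).

-- earlier Assembly (stmt-QuantumFields-16194, replaced 2026-08-16T18:31:50Z -> stmt-QuantumFields-16321): retired by None — CurvatureAmnesia → HypercubicLimit → WeakCouplingSpeciesProjection → EuclideanUpgrade → YangMills
-- earlier Assembly (stmt-QuantumFields-8651, replaced 2026-08-16T17:58:36Z -> stmt-QuantumFields-16194): retired by None — CurvatureAmnesia → HypercubicLimit → SpeciesProjection → EuclideanUpgrade → YangMills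
/-- item stmt-QuantumFields-16321 · assembly · rank 1 · open · by planner
sources: OsterwalderSchrader1975, JaffeWitten2000
[assembly] CurvatureAmnesia → HypercubicLimit → YangMills — the two cruxes alone decide the summit
(restated rev 15, crux-only repair). Provable now: `fun h₁ h₂ => closes h₁ h₂ stub_upgrade` in a
Theorems file importing Theorems.LangevinControlUVOSLegsFromFemtoAndGapStubUpgrade (the deciding
theorem `closes : CurvatureAmnesia → HypercubicLimit → EuclideanUpgrade → YangMills` takes the
PROVED support EuclideanUpgrade, stmt-QuantumFields-8647, as a hypothesis only because its landed
proof imports the route file and cannot be named in it; the species bookkeeping is proved inside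
`closes`). -/
@[route_item "route-QuantumFields-CoincidenceRotationBootstrap"]
def Assembly : Prop :=
  CurvatureAmnesia → HypercubicLimit → YangMills

/-! D-0027 §2.1 — DECIDING THEOREM (planner-authored via `route open/edit --closes-file`; by planner-rbadge-QuantumFields-CoincidenceRotati-1d1bad44-g3-0 2026-08-16T18:31:50Z):
its hypotheses are this route's items and its conclusion the sub-problem Statement (glue_lint), and it elaborates with this file. -/

@[closes "route-QuantumFields-CoincidenceRotationBootstrap"] theorem closes (h₁ : CurvatureAmnesia) (h₂ : HypercubicLimit) (h₃ : EuclideanUpgrade) : YangMills := by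
  -- CRUX-ONLY deciding theorem (route-repair gen 3, 2026-08-16): hypotheses = the cruxes CurvatureAmnesia,
  -- HypercubicLimit and the PROVED support EuclideanUpgrade (stmt-8647, closed); the species bookkeeping
  -- (formerly the support WeakCouplingSpeciesProjection) is proved inline: sch' renormalises every
  -- non-curvature species to 0 (same a, β, L, m), S' := S on all-curvature label strings, 0 elsewhere.
  intro G _ _ _ _ hG
  letI : MeasurableSpace G := borel G
  haveI : BorelSpace G := ⟨rfl⟩
  obtain ⟨r, sch, S, hW, hax, hYM, hNT, hNG, Δ, hΔ, hg1, hg2⟩ := h₂ G hG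
  have hsig := h₁ G hG r sch S hW hax hYM hNT ⟨Δ, hΔ, hg1, hg2⟩
  obtain ⟨h0, hh, hg, hrp, hsy, hcl, htr, hcub⟩ := hax
  -- label-string bookkeeping
  have hrev : ∀ {ι : Type} {n : ℕ} (k : Fin n → ι) (c : ι), (∀ i, (k ∘ Fin.rev) i = c) ↔ ∀ i, k i = c :=
    fun k c => ⟨fun h i => by simpa using h (Fin.rev i), fun h i => h _⟩
  have happ : ∀ {ι : Type} {n m : ℕ} (k : Fin n → ι) (k' : Fin m → ι) (c : ι),
      (∀ i, Fin.append k k' i = c) ↔ (∀ i, k i = c) ∧ ∀ j, k' j = c := by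
    intro ι n m k k' c
    refine ⟨fun h => ⟨fun i => by simpa using h (Fin.castAdd m i), fun j => by simpa using h (Fin.natAdd n j)⟩,
      fun h i => ?_⟩
    induction i using Fin.addCases with
    | left i => simpa using h.1 i
    | right j => simpa using h.2 j
  have hcst : ∀ {ι : Type} {a b : ℕ} (c : ι),
      Fin.append ((fun _ : Fin a => c) ∘ Fin.rev) (fun _ : Fin b => c) = fun _ => c := by
    intro ι a b c
    funext i
    induction i using Fin.addCases with
    | left i => simp
    | right j => simp
  -- the projected scheme and its lattice correlations
  let sch' := { sch with c := fun s j => if s = r.curvature then sch.c s j else 0 }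
  have hself : ∀ (j n : ℕ) (f : Fin n → SchwartzMap (EuclideanSpace ℝ (Fin 4)) ℝ),
      Literature.MathematicalPhysics.QuantumFieldTheory.latticeSchwinger r.ρ sch' (fun s => s.F) j n
        (fun _ => r.curvature) f = Literature.MathematicalPhysics.QuantumFieldTheory.latticeSchwinger
          r.ρ sch (fun s => s.F) j n (fun _ => r.curvature) f := by
    intro j n f
    have hc : sch'.c r.curvature j = sch.c r.curvature j := if_pos rfl
    unfold Literature.MathematicalPhysics.QuantumFieldTheory.latticeSchwinger
    simp_rw [hc]
    rfl
  have hne : ∀ (j n : ℕ) (σ : Fin n → _) (f : Fin n → SchwartzMap (EuclideanSpace ℝ (Fin 4)) ℝ) (i₀ : Fin n),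
      σ i₀ ≠ r.curvature →
        Literature.MathematicalPhysics.QuantumFieldTheory.latticeSchwinger r.ρ sch' (fun s => s.F) j n σ f = 0 := by
    intro j n σ f i₀ hi₀
    have hc : sch'.c (σ i₀) j = 0 := if_neg hi₀
    unfold Literature.MathematicalPhysics.QuantumFieldTheory.latticeSchwinger
    refine integral_eq_zero_of_ae (Filter.Eventually.of_forall fun U => ?_)
    simp only [Pi.zero_apply]
    refine Finset.prod_eq_zero (Finset.mem_univ i₀) ?_
    rw [hc]
    simp [Literature.MathematicalPhysics.QuantumFieldTheory.smearedLatticeField]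
  -- the projected family
  obtain ⟨S', ha, hn⟩ : ∃ S' : Literature.MathematicalPhysics.AQFT.LabelledSchwingerFamily
      (Literature.MathematicalPhysics.QuantumFieldTheory.YMSpecies G) (EuclideanSpace ℝ (Fin 4)),
      (∀ (n : ℕ) (k : Fin n → _), (∀ i, k i = r.curvature) → S' n k = S n (fun _ => r.curvature)) ∧
      (∀ (n : ℕ) (k : Fin n → _), ¬ (∀ i, k i = r.curvature) → S' n k = 0) :=
    ⟨fun n k => if (∀ i, k i = r.curvature) then S n (fun _ => r.curvature) else 0,
      fun n k hk => if_pos hk, fun n k hk => if_neg hk⟩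
  have hac : ∀ n : ℕ, S' n (fun _ => r.curvature) = S n (fun _ => r.curvature) := fun n => ha n _ fun _ => rfl
  refine ⟨r, sch', ⟨S', ?_, ?_, ?_, ⟨?_, ?_⟩, ?_, ?_, ?_⟩, hW, ?_, ?_, ?_, Δ, hΔ, ?_, hg2⟩
  · -- E0 normalisation
    intro k F
    rw [ha 0 k (fun i => i.elim0)]
    exact h0 _ F
  · -- E0 hermiticity
    intro n k F hF
    by_cases hk : ∀ i, k i = r.curvature
    · rw [ha n k hk, ha n _ ((hrev k _).2 hk)]
      exact hh n _ F hF
    · rw [hn n k hk, hn n _ (mt (hrev k _).1 hk)]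
      simp
  · -- E0' linear growth
    intro T
    obtain ⟨s, α, β, hb⟩ := hg {r.curvature}
    refine ⟨s, max α 0, β, fun n k _ F hF => ?_⟩
    have hnn : 0 ≤ (n.factorial : ℝ) ^ β * Literature.MathematicalPhysics.QuantumLattice.schwartzNorm (n * s) F :=
      mul_nonneg (Real.rpow_nonneg (Nat.cast_nonneg _) _)
        (Literature.MathematicalPhysics.QuantumLattice.schwartzNorm_nonneg _ _)
    by_cases hk : ∀ i, k i = r.curvature
    · rw [ha n k hk]
      refine (hb n _ (fun _ => Finset.mem_singleton_self _) F hF).trans ?_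
      rw [mul_assoc, mul_assoc]
      exact mul_le_mul_of_nonneg_right (le_max_left _ _) hnn
    · rw [hn n k hk]
      show ‖(0 : ℂ)‖ ≤ _
      rw [norm_zero, mul_assoc]
      exact mul_nonneg (le_max_right _ _) hnn
  · -- E1 translations
    intro n k a F hF
    by_cases hk : ∀ i, k i = r.curvature
    · rw [ha n k hk]; exact htr n _ a F hF
    · rw [hn n k hk]; rfl
  · -- E1 rotations: the PROVED support EuclideanUpgrade, fed proper-hypercubic invariance and Σ5-invariance
    -- of EVERY species string (curvature strings by CurvatureAmnesia, the others vanish)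
    exact h₃ _ S'
      (fun n k R hR hp F hF => by
        by_cases hk : ∀ i, k i = r.curvature
        · rw [ha n k hk]; exact hcub n _ R hR hp F hF
        · rw [hn n k hk]; rfl)
      (fun R hR n k F hF => by
        by_cases hk : ∀ i, k i = r.curvature
        · rw [ha n k hk]; exact hsig R hR n F hF
        · rw [hn n k hk]; rfl)
  · -- E2 reflection positivity: zero the test functions of label strings that are not all-curvature
    intro N deg lab F hF H hH
    let good : Fin N → Prop := fun j => ∀ i, lab j i = r.curvature
    let F' : (j : Fin N) → SchwartzMap (Fin (deg j) → EuclideanSpace ℝ (Fin 4)) ℂ :=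
      fun j => if good j then F j else 0
    let H' : (i j : Fin N) → SchwartzMap (Fin (deg i + deg j) → EuclideanSpace ℝ (Fin 4)) ℂ :=
      fun i j => if good i ∧ good j then H i j else 0
    have hF' : ∀ j, Literature.MathematicalPhysics.QuantumLattice.IsTimeOrdered (F' j) := fun j => by
      by_cases hj : good j
      · simp only [F', if_pos hj]; exact hF j
      · simp only [F', if_neg hj]
        rw [Literature.MathematicalPhysics.QuantumLattice.IsTimeOrdered,
          show ((0 : SchwartzMap (Fin (deg j) → EuclideanSpace ℝ (Fin 4)) ℂ) :
            (Fin (deg j) → EuclideanSpace ℝ (Fin 4)) → ℂ) = 0 from rfl, tsupport_zero]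
        exact Set.empty_subset _
    have hH' : ∀ i j, Literature.MathematicalPhysics.QuantumLattice.IsAppendTensorOf (H' i j)
        (Literature.MathematicalPhysics.QuantumLattice.osAdjoint (F' i)) (F' j) := fun i j => by
      by_cases hi : good i
      · by_cases hj : good j
        · simp only [H', F', if_pos hi, if_pos hj, if_pos (And.intro hi hj)]; exact hH i j
        · simp only [H', F', if_neg hj, if_neg (fun h : good i ∧ good j => hj h.2)]
          intro x; simp
      · simp only [H', F', if_neg hi, if_neg (fun h : good i ∧ good j => hi h.1)]
        intro x; simp
    have key := hrp N deg (fun j _ => r.curvature) F' hF' H' hH'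
    have hterm : ∀ i j, S' (deg i + deg j) (Fin.append (lab i ∘ Fin.rev) (lab j)) (H i j) =
        S (deg i + deg j) (Fin.append ((fun _ => r.curvature) ∘ Fin.rev) (fun _ => r.curvature)) (H' i j) := by
      intro i j
      by_cases hij : good i ∧ good j
      · rw [ha _ _ ((happ _ _ _).2 ⟨(hrev _ _).2 hij.1, hij.2⟩), hcst]
        simp only [H', if_pos hij]
      · rw [hn _ _ (fun h => hij ⟨(hrev _ _).1 ((happ _ _ _).1 h).1, ((happ _ _ _).1 h).2⟩)]
        simp [H', if_neg hij]
    simp only [hterm]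
    exact key
  · -- E3 symmetry
    intro n k π F hF
    by_cases hk : ∀ i, k i = r.curvature
    · rw [ha n k hk, ha n (k ∘ π) (fun i => hk _)]
      exact hsy n _ π F hF
    · rw [hn n k hk, hn n (k ∘ π) (fun h => hk fun i => by simpa using h (π.symm i))]
      simp
  · -- E4 cluster property
    intro n m k k' F G hF hG a ha0 hane H hH
    by_cases hk : ∀ i, k i = r.curvature
    · by_cases hk' : ∀ j, k' j = r.curvature
      · rw [ha _ _ ((happ _ _ _).2 ⟨(hrev _ _).2 hk, hk'⟩), ha _ _ ((hrev _ _).2 hk), ha _ _ hk']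
        have := hcl n m (fun _ => r.curvature) (fun _ => r.curvature) F G hF hG a ha0 hane H hH
        rw [hcst] at this
        exact this
      · rw [hn _ _ (fun h => hk' ((happ _ _ _).1 h).2), hn _ _ hk']
        simp
    · rw [hn _ _ (fun h => hk ((hrev _ _).1 ((happ _ _ _).1 h).1)), hn _ _ (mt (hrev k _).1 hk)]
      simp
  · -- IsYangMillsFor along the projected scheme
    intro n hn0 σ f F hF hod
    dsimp only
    by_cases hσ : ∀ i, σ i = r.curvature
    · obtain rfl : σ = fun _ => r.curvature := funext hσ
      rw [hac n]
      simp only [hself]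
      exact hYM n hn0 _ f F hF hod
    · push Not at hσ
      obtain ⟨i₀, hi₀⟩ := hσ
      rw [hn n σ (fun h => hi₀ (h i₀))]
      simp only [hne _ n σ f i₀ hi₀, Complex.ofReal_zero]
      exact tendsto_const_nhds
  · -- non-triviality of the curvature field (S' = S on curvature strings)
    obtain ⟨F₁, G₁, H₁, hF₁, hG₁, hH₁, hne₁⟩ := hNT
    refine ⟨F₁, G₁, H₁, hF₁, hG₁, hH₁, ?_⟩
    dsimp only
    rw [hac, hac]
    exact hne₁
  · -- non-Gaussianity of the curvature field
    obtain ⟨f, g, h, A3, B1, B2, B3, C1, C2, C3, t1, t2, t3, t4, t5, t6, t7, t8, hne₃⟩ := hNG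
    refine ⟨f, g, h, A3, B1, B2, B3, C1, C2, C3, t1, t2, t3, t4, t5, t6, t7, t8, ?_⟩
    dsimp only
    rw [hac 3, hac 2, hac 1]
    exact hne₃
  · -- full-spectrum mass gap of S'
    intro n m k k' F G hF hG
    dsimp only
    by_cases hk : ∀ i, k i = r.curvature
    · by_cases hk' : ∀ j, k' j = r.curvature
      · obtain ⟨C, hC⟩ := hg1 n m (fun _ => r.curvature) (fun _ => r.curvature) F G hF hG
        refine ⟨C, fun t ht H hH => ?_⟩
        rw [ha _ _ ((happ _ _ _).2 ⟨(hrev _ _).2 hk, hk'⟩), ha _ _ ((hrev _ _).2 hk), ha _ _ hk']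
        have := hC t ht H hH
        rw [hcst] at this
        exact this
      · refine ⟨0, fun t ht H hH => ?_⟩
        rw [hn _ _ (fun h => hk' ((happ _ _ _).1 h).2), hn _ _ hk']
        simp
    · refine ⟨0, fun t ht H hH => ?_⟩
      rw [hn _ _ (fun h => hk ((hrev _ _).1 ((happ _ _ _).1 h).1)), hn _ _ (mt (hrev k _).1 hk)]
      simp

end Summit.QuantumFields.YangMills.Theses.CoincidenceRotationBootstrap
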